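import Summits.ResolutionOfSingularities.ResolutionOfSingularities.Theorems.EquisingularLiftEquisingularLiftNatHypLocPrincipalScheme
import Summits.ResolutionOfSingularities.ResolutionOfSingularities.Theorems.EquisingularLiftEquisingularLiftNatCompleteIntersectionLiftSmooth
import Literature.RingTheory.MvPolynomial.BinaryFormLinearFactors
import Mathlib.RingTheory.MvPolynomial.EulerIdentity
import Mathlib.Algebra.MvPolynomial.Nilpotent
import HarnessLib

/-!
# EL♮ / EL♮(3) — a NON-REGULAR `H` of the crux is a prime-form hypersurface of degree `≥ 2`

leafhand-res-equisingularlift-5 g0 (prover, 2026-08-31; cell `pub/decomp-res`; item (r1) of leafhand-4's repair census, degree refinement).  Crux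
`EquisingularLiftNatThree` (`stmt-…-20148`; uniform in `n`), line W4.5(b).  DEF-FREE; no `sorry`; standard axioms; ZERO named hypotheses;
`--supports stmt-…-20148 --as helper`, counted 0.

The residue stubs of the EL♮(3) skeletons carry `¬ Scheme.IsRegular H` (the regular case is the empty tower).  Under that hypothesis the dictionary
✓ `LargeChar.isIso_or_exists_prime_form_ker_eq_of_hyp` (…NatHypLocPrincipalScheme) sharpens to: `range ι = V₊(F)`, `ker ι = (F)~` for a PRIME FORM
`F` of degree `e ≥ 2` — hyperplanes are regular:

* `exists_pderiv_eq_C_ne_zero` — a non-zero linear form has a partial derivative which is a non-zero constant (Euler's identity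
  `Σ xᵢ ∂ᵢℓ = ℓ`, Mathlib `IsHomogeneous.sum_X_mul_pderiv`);
* `isRegular_subscheme_projIdealSheaf_linear` — the zero scheme `V((ℓ)~)` of a non-zero LINEAR form is regular (the Jacobian criterion
  ✓ `CILift.isRegular_subscheme_projIdealSheaf_of_jacobian` with the `1 × 1` minor `∂ⱼℓ = c ≠ 0`);
* ★ `exists_prime_form_two_le_of_not_isRegular` — **the crux hypotheses with `H` NOT regular ⟹ `range ι = V₊(F)` and `ker ι = (F)~` for a prime
  form `F` of degree `≥ 2`** (and `n ≥ 1`).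
* (appended) `eq_one_of_prime_binaryForm` — over an ALGEBRAICALLY CLOSED field a prime binary form is linear (binary forms split,
  ✓ `Literature.RingTheory.MvPolynomial.exists_prod_isHomogeneous_one`); ★ `two_le_and_exists_prime_form_of_not_isRegular` — with `k` algebraically
  closed (as in the crux), a non-regular `H` lives in `ℙⁿ` with `n ≥ 2` (plane curves and beyond) and is a prime-form hypersurface of degree `≥ 2`.

HONEST: dictionary only; EL♮(3) / EL♮ / `EquisingularLift` NOT proved; no registered stub closed; resolution in positive characteristic NOT proved.
AI-written; AI review is weaker than expert review. [cite: Hartshorne1977, I Ex. 5.8 and II Prop. 6.4] (method; index only)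
-/

set_option linter.dupNamespace false -- mandated namespace `Summit.<Summit>.<Problem>` of this single-conjunct summit

noncomputable section

open CategoryTheory CategoryTheory.Limits AlgebraicGeometry TopologicalSpace Topology
open MvPolynomial
open Literature.AlgebraicGeometry.Resolution Literature.AlgebraicGeometry.Motives
open AlgebraicGeometry.Scheme.IdealSheafData

universe u

namespace Summit.ResolutionOfSingularities.ResolutionOfSingularities.Cruxes.EquisingularLiftNat.Sections

namespace LargeChar

/-- **A non-zero linear form has a partial derivative which is a non-zero constant**: each `∂ⱼℓ` is a form of degree `0`, i.e. a constant,
and if all of them vanished then `ℓ = Σⱼ xⱼ ∂ⱼℓ = 0` (Euler). [folklore] -/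
theorem exists_pderiv_eq_C_ne_zero {k : Type u} [Field k] {m : ℕ} (ℓ : MvPolynomial (Fin m) k) (hℓ : ℓ.IsHomogeneous 1)
    (hℓ0 : ℓ ≠ 0) : ∃ (j : Fin m) (c : k), c ≠ 0 ∧ pderiv j ℓ = C c := by
  classical
  -- every partial derivative is a constant
  have hC : ∀ j : Fin m, pderiv j ℓ = C ((pderiv j ℓ).coeff 0) := fun j => by
    have hhom : (pderiv j ℓ).IsHomogeneous 0 := by simpa using hℓ.pderiv (i := j)
    exact totalDegree_eq_zero_iff_eq_C.1 ((totalDegree_zero_iff_isHomogeneous _).2 hhom)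
  by_contra h
  push Not at h
  apply hℓ0
  have hzero : ∀ j : Fin m, pderiv j ℓ = 0 := fun j => by
    by_cases hc : (pderiv j ℓ).coeff 0 = 0
    · rw [hC j, hc, map_zero]
    · exact absurd (hC j) (h j _ hc)
  have heuler := hℓ.sum_X_mul_pderiv
  simp only [hzero, mul_zero, Finset.sum_const_zero, one_smul] at heuler
  exact heuler.symm

/-- **The zero scheme `V((ℓ)~) ⊆ ℙⁿ_k` of a non-zero LINEAR form is regular** (a hyperplane; the Jacobian criterion with the non-vanishing
`1 × 1` minor `∂ⱼℓ = c ≠ 0`). [cite: Hartshorne1977, I Ex. 5.8] [OURS · DEF-FREE] -/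
theorem isRegular_subscheme_projIdealSheaf_linear {k : Type} [Field k] {n : ℕ} (ℓ : MvPolynomial (Fin (n + 1)) k)
    (hℓ : ℓ.IsHomogeneous 1) (hℓ0 : ℓ ≠ 0) :
    letI := MvPolynomial.gradedAlgebra (σ := Fin (n + 1)) (R := k)
    Scheme.IsRegular (projIdealSheaf (homogeneousSubmodule (Fin (n + 1)) k)
      ⟨Ideal.span (Set.range fun _ : Fin 1 => ℓ),
        isHomogeneous_span_of_forall_mem _ (fun _ : Fin 1 => ℓ) (fun _ => 1)
          (fun _ => (mem_homogeneousSubmodule 1 ℓ).2 hℓ)⟩).subscheme := by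
  classical
  letI := MvPolynomial.gradedAlgebra (σ := Fin (n + 1)) (R := k)
  obtain ⟨j, c, hc, hj⟩ := exists_pderiv_eq_C_ne_zero ℓ hℓ hℓ0
  refine CILift.isRegular_subscheme_projIdealSheaf_of_jacobian (fun _ : Fin 1 => ℓ) (fun _ => 1)
    (fun _ => (mem_homogeneousSubmodule 1 ℓ).2 hℓ) fun y _ => ⟨⟨fun _ => j, fun a b _ => Subsingleton.elim a b⟩, ?_⟩
  rw [Matrix.det_fin_one, Matrix.of_apply]
  change pderiv j ℓ ∉ y.asHomogeneousIdeal
  rw [hj]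
  intro hmem
  have hunit : IsUnit (C c : MvPolynomial (Fin (n + 1)) k) := (isUnit_iff_ne_zero.2 hc).map C
  exact y.isPrime.ne_top (Ideal.eq_top_of_isUnit_mem _ hmem hunit)

/-- ★ **A non-regular `H` of the crux is a prime-form hypersurface of degree `≥ 2`.**  `ι : H ↪ ℙⁿ_k` a closed immersion, `H` integral and NOT
regular, `(ker ι)(U)` principal near every point (`HypLocPrincipal`, verbatim) ⟹ `n ≥ 1` and there is a PRIME FORM `F` of degree `e ≥ 2` with
`range ι = V₊(F)` and `ker ι = (F)~` (the isomorphism case and the hyperplane case `e = 1` give a regular `H`: ✓ `isRegular_projectiveSpace`,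
`isRegular_subscheme_projIdealSheaf_linear`, ✓ `exists_iso_subscheme_projIdealSheaf_form`). [OURS · L1 W4.5b · crux-hypothesis packaging; DEF-FREE] -/
theorem exists_prime_form_two_le_of_not_isRegular {k : Type} [Field k] {n : ℕ} {H : Scheme.{0}}
    (ι : H ⟶ (Literature.AlgebraicGeometry.Motives.projectiveSpace n k).left) [IsClosedImmersion ι] [IsIntegral H]
    (hpr : ∀ y : (Literature.AlgebraicGeometry.Motives.projectiveSpace n k).left,
      ∃ U : (Literature.AlgebraicGeometry.Motives.projectiveSpace n k).left.affineOpens,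
        y ∈ (U : (Literature.AlgebraicGeometry.Motives.projectiveSpace n k).left.Opens) ∧ (ι.ker.ideal U).IsPrincipal)
    (hH : ¬ Scheme.IsRegular H) :
    1 ≤ n ∧ ∃ (e : ℕ) (F : MvPolynomial (Fin (n + 1)) k) (hF : F.IsHomogeneous e), 2 ≤ e ∧ Prime F ∧
      letI := MvPolynomial.gradedAlgebra (σ := Fin (n + 1)) (R := k)
      Set.range ι = {x : Proj (homogeneousSubmodule (Fin (n + 1)) k) | F ∈ x.asHomogeneousIdeal} ∧
      ι.ker = projIdealSheaf (homogeneousSubmodule (Fin (n + 1)) k)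
        ⟨Ideal.span (Set.range fun _ : Fin 1 => F),
          isHomogeneous_span_of_forall_mem _ (fun _ : Fin 1 => F) (fun _ => e)
            (fun _ => (mem_homogeneousSubmodule e F).2 hF)⟩ := by
  letI := MvPolynomial.gradedAlgebra (σ := Fin (n + 1)) (R := k)
  rcases isIso_or_exists_prime_form_ker_eq_of_hyp ι hpr with hiso | ⟨e, F, hF, he, hprime, hrange, hker⟩
  · haveI := hiso
    exact absurd (Scheme.IsRegular.of_iso (inv ι) (isRegular_projectiveSpace n k)) hH
  · -- `n ≥ 1`: `ℙ⁰` carries no hypersurface point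
    have hn : 1 ≤ n := by
      cases n with
      | zero =>
        exfalso
        haveI : Nonempty H := inferInstance
        obtain ⟨x⟩ := this
        have hx : F ∈ (ι x).asHomogeneousIdeal := by
          have h : ι x ∈ Set.range ι := ⟨x, rfl⟩
          rw [hrange] at h
          exact h
        exact not_mem_asHomogeneousIdeal_of_fin_one k F hF hprime.ne_zero (ι x) hx
      | succ d => omega
    refine ⟨hn, e, F, hF, ?_, hprime, hrange, hker⟩
    by_contra hlt
    have he1 : e = 1 := by omega
    subst he1
    apply hH
    obtain ⟨φ, -⟩ := exists_iso_subscheme_projIdealSheaf_form ι hn F hF hprime hrange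
    exact Scheme.IsRegular.of_iso φ.inv (isRegular_subscheme_projIdealSheaf_linear F hF hprime.ne_zero)

/-! ## Over an algebraically closed field: `n ≥ 2` -/

/-- **Over an algebraically closed field a PRIME binary form is linear**: a binary form of degree `e ≥ 1` is a product of `e` linear forms
(✓ `exists_prod_isHomogeneous_one`), none of which is a unit; a prime is irreducible. [cite: Hartshorne1977, I Ex. 5.8] [folklore] -/
theorem eq_one_of_prime_binaryForm {k : Type u} [Field k] [IsAlgClosed k] {e : ℕ} {F : MvPolynomial (Fin 2) k}
    (hF : F.IsHomogeneous e) (hprime : Prime F) : e = 1 := by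
  classical
  have he : e ≠ 0 := by
    intro h
    subst h
    have hC := totalDegree_eq_zero_iff_eq_C.1 ((totalDegree_zero_iff_isHomogeneous _).2 hF)
    by_cases hc : F.coeff 0 = 0
    · exact hprime.ne_zero (by rw [hC, hc, map_zero])
    · exact hprime.not_unit (by rw [hC]; exact (isUnit_iff_ne_zero.2 hc).map C)
  obtain ⟨ℓ, hℓ, hFprod⟩ := Literature.RingTheory.MvPolynomial.exists_prod_isHomogeneous_one hF he
  -- the linear factors are non-units
  have hnu : ∀ i, ¬ IsUnit (ℓ i) := by
    intro i hu
    have h0 : (ℓ i).totalDegree = 0 := (isUnit_iff_totalDegree_of_isReduced.1 hu).2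
    have hne : ℓ i ≠ 0 := by
      intro h
      apply hprime.ne_zero
      rw [hFprod]
      exact Finset.prod_eq_zero (Finset.mem_univ i) h
    have h1 : (ℓ i).totalDegree = 1 := (hℓ i).totalDegree hne
    omega
  by_contra hne1
  obtain ⟨m, rfl⟩ : ∃ m, e = m + 2 := ⟨e - 2, by omega⟩
  rw [Fin.prod_univ_succ] at hFprod
  rcases hprime.irreducible.isUnit_or_isUnit hFprod with h | h
  · exact hnu 0 h
  · exact hnu (Fin.succ 0)
      (isUnit_of_dvd_unit (Finset.dvd_prod_of_mem (fun i : Fin (m + 1) => ℓ i.succ) (Finset.mem_univ (0 : Fin (m + 1)))) h)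

/-- ★ **With `k` algebraically closed (as in the crux): a non-regular `H` lives in `ℙⁿ` with `n ≥ 2` and is a prime-form hypersurface of degree
`≥ 2`** (for `n = 1` a prime binary form is linear, `eq_one_of_prime_binaryForm`, contradicting degree `≥ 2`).
[OURS · L1 W4.5b · crux-hypothesis packaging; DEF-FREE] -/
theorem two_le_and_exists_prime_form_of_not_isRegular {k : Type} [Field k] [IsAlgClosed k] {n : ℕ} {H : Scheme.{0}}
    (ι : H ⟶ (Literature.AlgebraicGeometry.Motives.projectiveSpace n k).left) [IsClosedImmersion ι] [IsIntegral H]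
    (hpr : ∀ y : (Literature.AlgebraicGeometry.Motives.projectiveSpace n k).left,
      ∃ U : (Literature.AlgebraicGeometry.Motives.projectiveSpace n k).left.affineOpens,
        y ∈ (U : (Literature.AlgebraicGeometry.Motives.projectiveSpace n k).left.Opens) ∧ (ι.ker.ideal U).IsPrincipal)
    (hH : ¬ Scheme.IsRegular H) :
    2 ≤ n ∧ ∃ (e : ℕ) (F : MvPolynomial (Fin (n + 1)) k) (hF : F.IsHomogeneous e), 2 ≤ e ∧ Prime F ∧
      letI := MvPolynomial.gradedAlgebra (σ := Fin (n + 1)) (R := k)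
      Set.range ι = {x : Proj (homogeneousSubmodule (Fin (n + 1)) k) | F ∈ x.asHomogeneousIdeal} ∧
      ι.ker = projIdealSheaf (homogeneousSubmodule (Fin (n + 1)) k)
        ⟨Ideal.span (Set.range fun _ : Fin 1 => F),
          isHomogeneous_span_of_forall_mem _ (fun _ : Fin 1 => F) (fun _ => e)
            (fun _ => (mem_homogeneousSubmodule e F).2 hF)⟩ := by
  obtain ⟨hn, e, F, hF, he, hprime, hrange, hker⟩ := exists_prime_form_two_le_of_not_isRegular ι hpr hH
  refine ⟨?_, e, F, hF, he, hprime, hrange, hker⟩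
  by_contra hlt
  obtain rfl : n = 1 := by omega
  have h1 := eq_one_of_prime_binaryForm hF hprime
  omega

end LargeChar

end Summit.ResolutionOfSingularities.ResolutionOfSingularities.Cruxes.EquisingularLiftNat.Sections

end
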